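import Summits.Ventures.LatticeQCDFlow.Scaling.ReplicaExchangeSectorFlow
import Summits.Ventures.LatticeQCDFlow.Scaling.EquilibriumHittingFloor

/-!
HONEST FRAMING: exact (Metropolis-corrected) sampling algorithms for lattice gauge theory; figures
of merit are autocorrelation/cost numbers at stated couplings and volumes; no continuum-physics
claim.

# ReplicaExchangeSectorHitting — FROM EQUILIBRIUM, REPLICA EXCHANGE FIRST HOLDS A SECTOR-`A` CONFIGURATION IN SOME
# REPLICA NO SOONER THAN THE UPDATES PRODUCE ONE:
# `E_π(H^{U_A} ∧ N) ≥ N·Π_k μ_k(Aᶜ) − ½N(N−1)·((1−t)/(K+1))·Σ_k Q_k(Aᶜ,A)` FOR EVERY HORIZON `N` (lean-2 GEN-17, ours)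

Venture-side (OURS).  Cell `lqcd-flow` (pub-lqcd), unit `pub-lqcd-lean-2-g17`, 2026-08-25.  Docking of the generic
`Scaling/EquilibriumHittingFloor` (`Σ_i π(i)E_i(H^B ∧ N) ≥ N·π(Bᶜ) − ½N(N−1)·Q(B,Bᶜ)`, stationarity only) to
`Scaling/ReplicaExchangeSectorFlow` (`U_A = sectorHit A`: swap-invariant, `Q_P(U_Aᶜ,U_A) ≤ ((1−t)/(K+1))Σ_k Q_k(Aᶜ,A)`,
`π(U_Aᶜ) = Π_k μ_k(Aᶜ)`), in the setting of `Scaling/ReplicaExchangeFiniteSampler` (`0 ≤ t ≤ 1`).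

## What is proved

* **`ptFin_sectorHitting_ge`** — for every set `A` of configurations and every horizon `N`,
  `Σ_p π(p)·E_p(H^{U_A} ∧ N) ≥ N·Π_k μ_k(Aᶜ) − ½N(N−1)·((1−t)/(K+1))·Σ_k Q_k(Aᶜ,A)`;
  **`ptFin_sectorHitting_ge_half`** — while `(N−1)(1−t)·Σ_k Q_k(Aᶜ,A) ≤ (K+1)·Π_k μ_k(Aᶜ)`:
  `Σ_p π(p)·E_p(H^{U_A} ∧ N) ≥ ½N·Π_k μ_k(Aᶜ)`.

Reading (no numerics implied): a swap never creates a sector-`A` configuration, so the first time ANY replica holds one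
is governed by the within-replica entrance flows `Q_k(Aᶜ,A)` summed over the ladder — for a sector that every level's
update enters at stationary rate `≤ ε`, of order `(K+1)Π_kμ_k(Aᶜ)/((1−t)(K+1)ε)` steps.  NOT CLAIMED: tail bounds;
anything measured.  Literature grade (cell rule): ELEMENTARY, NEW TYPING; nothing cited as a fact; no new bib keys.
-/

noncomputable section

open Finset
open Literature.Probability.MarkovChains

namespace Summit.Ventures.LatticeQCDFlow.Scaling

variable {S : Type*} [Fintype S] [DecidableEq S] {K : ℕ} {μ : Fin (K + 1) → S → ℝ}
  {M : Fin (K + 1) → S → S → ℝ} {t : ℝ}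

variable (hμ : ∀ k x, 0 < μ k x) (hμ1 : ∀ k, ∑ x, μ k x = 1) (hM : ∀ k, IsRowStochastic (M k))
  (hMrev : ∀ k, DetailedBalance (μ k) (M k)) (ht0 : 0 ≤ t) (ht1 : t ≤ 1)
include hμ hμ1 hM hMrev ht0 ht1

/-- **FROM EQUILIBRIUM, SOME REPLICA FIRST HOLDS A SECTOR-`A` CONFIGURATION LATE:** for every horizon `N`,
`Σ_p π(p)E_p(H^{U_A} ∧ N) ≥ N·Π_k μ_k(Aᶜ) − ½N(N−1)·((1−t)/(K+1))·Σ_k Q_k(Aᶜ,A)`. [ours] -/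
theorem ptFin_sectorHitting_ge (A : Finset S) (N : ℕ) :
    N * (∏ k : Fin (K + 1), ∑ u ∈ Aᶜ, μ k u)
        - (N * (N - 1) / 2) * ((1 - t) / (K + 1) * ∑ k, edgeMeasure (μ k) (M k) Aᶜ A)
      ≤ ∑ p, ptFinLaw μ p
          * meanHitWithin (ptFinSampler t μ M) (↑(sectorHit (K := K) A) : Set (Fin (K + 1) × (Fin (K + 1) → S))) N p := by
  have hP := ptFinSampler_isRowStochastic (M := M) hμ hM ht0 ht1
  have hst : IsStationary (ptFinLaw μ) (ptFinSampler t μ M) :=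
    (ptFinSampler_detailedBalance (t := t) (M := M) hμ hMrev).isStationary hP.2
  have h := stationaryMean_meanHitWithin_ge hP hst (fun p => (ptFinLaw_pos hμ p).le) (sectorHit (K := K) A) N
  rw [ptFin_mass_not_sectorHit, edgeMeasure_compl_comm hP hst] at h
  have hQ := ptFin_edgeMeasure_sectorHit_le (t := t) hμ hμ1 hM ht1 A
  have hN : 0 ≤ (N : ℝ) * (N - 1) / 2 := by
    rcases Nat.eq_zero_or_pos N with h0 | hpos
    · simp [h0]
    · have : (1 : ℝ) ≤ N := by exact_mod_cast hpos
      have : (0 : ℝ) ≤ N - 1 := by linarith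
      positivity
  nlinarith [mul_le_mul_of_nonneg_left hQ hN]

/-- **While `(N−1)(1−t)·Σ_k Q_k(Aᶜ,A) ≤ (K+1)·Π_k μ_k(Aᶜ)`, the equilibrium-averaged truncated hitting time of "some
replica in `A`" is at least `½N·Π_k μ_k(Aᶜ)`.** [ours] -/
theorem ptFin_sectorHitting_ge_half (A : Finset S) (N : ℕ)
    (hN : ((N : ℝ) - 1) * ((1 - t) * ∑ k, edgeMeasure (μ k) (M k) Aᶜ A)
      ≤ (K + 1) * ∏ k : Fin (K + 1), ∑ u ∈ Aᶜ, μ k u) :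
    (N : ℝ) * (∏ k : Fin (K + 1), ∑ u ∈ Aᶜ, μ k u) / 2
      ≤ ∑ p, ptFinLaw μ p
          * meanHitWithin (ptFinSampler t μ M) (↑(sectorHit (K := K) A) : Set (Fin (K + 1) × (Fin (K + 1) → S))) N p := by
  have h := ptFin_sectorHitting_ge hμ hμ1 hM hMrev ht0 ht1 A N
  have hK : (0 : ℝ) < K + 1 := by positivity
  have hN0 : (0 : ℝ) ≤ N := Nat.cast_nonneg N
  -- `(N−1)·c ≤ Π` with `c = ((1−t)/(K+1))ΣQ`
  have hN' : ((N : ℝ) - 1) * ((1 - t) / (K + 1) * ∑ k, edgeMeasure (μ k) (M k) Aᶜ A)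
      ≤ ∏ k : Fin (K + 1), ∑ u ∈ Aᶜ, μ k u := by
    rw [show ((N : ℝ) - 1) * ((1 - t) / (K + 1) * ∑ k, edgeMeasure (μ k) (M k) Aᶜ A)
        = ((N : ℝ) - 1) * ((1 - t) * ∑ k, edgeMeasure (μ k) (M k) Aᶜ A) / (K + 1) by ring,
      div_le_iff₀ hK]
    linarith
  nlinarith [mul_le_mul_of_nonneg_left hN' hN0]

end Summit.Ventures.LatticeQCDFlow.Scaling

end
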